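import Summits.CriticalPhenomena.PercolationContinuityZ3.Theorems.SahiAEBorelVersionPi

/-!
# Borel everywhere-MTP₂ versions of densities vanishing off a measurable rectangle

Support file of the Sahi cell (`prim-sahi`, typer seat, generation 22; `--supports stmt-CriticalPhenomena-4575`).
Theorems only (no definitions, no named facts, no sorries).

The version theorems of `SahiAEBorelVersionPi.lean` (R5 under every finite product `π = ⊗ᵢ ρᵢ` of σ-finite measures
on `ℝ`) assume a density bounded away from `0`.  Densities WITH zeros are open in general (the separable tilt leaves a
non-rectangular support; lit g36, LITERATURE §41.6), except in two cases: `{0,1}`-valued densities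
(`exists_measurable_sublattice_version_of_ae`) and — this file — densities vanishing off a measurable RECTANGLE
`R = ∏ᵢ Sᵢ` and bounded away from `0` and `∞` on it:

* `inf_mem_pi_of_mem` / `sup_mem_pi_of_mem` — a product set `∏ᵢ Sᵢ ⊆ ℝ^ι` is a sublattice (the min / max of two
  reals is one of them);
* `exists_measurable_mtp2_version_of_ae_pi_rectangle` — if `f = 0` off `R`, `c ≤ f ≤ M` on `R` (`0 < c`, `M < ∞`)
  and `f` is MTP₂ on `π ⊗ π`-a.e. pair, then `f` has a bounded Borel version MTP₂ at EVERY pair, namely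
  `𝟙_R · F'` for a version `F'` under the product of the restricted measures `ρᵢ|_{Sᵢ}` (`= π|_R`) of `f` modified
  to `c` off `R`.

(Observation of prim-sahi-lit g36, cell INBOX 2026-08-21T18:49Z, item (2)(a).)  No sorries, no new axioms.
-/

noncomputable section

namespace Summit.CriticalPhenomena.PercolationContinuityZ3.Theorems.SahiAEFourFunctions

open MeasureTheory Set Filter Topology
open scoped ENNReal NNReal

variable {ι : Type*} [Fintype ι]

omit [Fintype ι] in
/-- A product set is closed under the coordinatewise minimum. [folklore] -/
theorem inf_mem_pi_of_mem {S : ι → Set ℝ} {x y : ι → ℝ} (hx : x ∈ Set.pi univ S) (hy : y ∈ Set.pi univ S) :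
    x ⊓ y ∈ Set.pi univ S := by
  rw [Set.mem_univ_pi] at hx hy ⊢
  intro i
  simp only [Pi.inf_apply]
  rcases le_total (x i) (y i) with h | h
  · rw [min_eq_left h]; exact hx i
  · rw [min_eq_right h]; exact hy i

omit [Fintype ι] in
/-- A product set is closed under the coordinatewise maximum. [folklore] -/
theorem sup_mem_pi_of_mem {S : ι → Set ℝ} {x y : ι → ℝ} (hx : x ∈ Set.pi univ S) (hy : y ∈ Set.pi univ S) :
    x ⊔ y ∈ Set.pi univ S := by
  rw [Set.mem_univ_pi] at hx hy ⊢
  intro i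
  simp only [Pi.sup_apply]
  rcases le_total (x i) (y i) with h | h
  · rw [max_eq_right h]; exact hy i
  · rw [max_eq_left h]; exact hx i

/-- **Densities vanishing off a measurable rectangle.**  Let `π = ⊗ᵢ ρᵢ` (σ-finite `ρᵢ` on `ℝ`), `R = ∏ᵢ Sᵢ` with
`Sᵢ` measurable, and `f : ℝ^ι → [0,∞]` measurable with `f = 0` off `R`, `c ≤ f ≤ M` on `R` (`0 < c`, `M < ∞`),
MTP₂ on `π ⊗ π`-almost every pair.  Then `f` has a bounded Borel version `F = f` `π`-a.e. with
`F(x) F(y) ≤ F(x ∧ y) F(x ∨ y)` for ALL `x, y` (`F = 𝟙_R · F'`, `F'` a version under `⊗ᵢ ρᵢ|_{Sᵢ} = π|_R`).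
[this work] -/
theorem exists_measurable_mtp2_version_of_ae_pi_rectangle (ρ : ι → Measure ℝ) [∀ i, SigmaFinite (ρ i)]
    (S : ι → Set ℝ) (hS : ∀ i, MeasurableSet (S i)) (f : (ι → ℝ) → ℝ≥0∞) (hf : Measurable f) {c M : ℝ≥0∞}
    (hc : c ≠ 0) (hM : M ≠ ∞) (hcf : ∀ x ∈ Set.pi univ S, c ≤ f x) (hfM : ∀ x ∈ Set.pi univ S, f x ≤ M)
    (hf0 : ∀ x ∉ Set.pi univ S, f x = 0)
    (hMTP : ∀ᵐ p ∂(Measure.pi ρ).prod (Measure.pi ρ), f p.1 * f p.2 ≤ f (p.1 ⊓ p.2) * f (p.1 ⊔ p.2)) :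
    ∃ F : (ι → ℝ) → ℝ≥0∞, Measurable F ∧ (∃ M' : ℝ≥0∞, M' ≠ ∞ ∧ ∀ x, F x ≤ M') ∧ F =ᵐ[Measure.pi ρ] f ∧
      ∀ x y, F x * F y ≤ F (x ⊓ y) * F (x ⊔ y) := by
  classical
  set R : Set (ι → ℝ) := Set.pi univ S with hR
  have mR : MeasurableSet R := MeasurableSet.univ_pi hS
  set π := Measure.pi ρ with hπ
  by_cases hcM : c ≤ M
  swap
  · -- then `R = ∅` pointwise and `f = 0`: the zero function is a version
    have hR0 : ∀ x, x ∉ R := fun x hx => hcM ((hcf x hx).trans (hfM x hx))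
    refine ⟨fun _ => 0, measurable_const, ⟨0, ENNReal.zero_ne_top, fun _ => le_rfl⟩,
      Eventually.of_forall fun x => (hf0 x (hR0 x)).symm, fun _ _ => by simp⟩
  have hcT : c ≠ ∞ := ne_top_of_le_ne_top hM hcM
  -- the restricted product measure `π|_R = ⊗ ρᵢ|_{Sᵢ}`
  set πS : Measure (ι → ℝ) := Measure.pi fun i => (ρ i).restrict (S i) with hπS
  have hπS_eq : πS = π.restrict R := by rw [hπS, hπ, hR, Measure.restrict_pi_pi]
  -- the modified density `g = f` on `R`, `c` off `R`
  set g : (ι → ℝ) → ℝ≥0∞ := R.piecewise f (fun _ => c) with hg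
  have hgm : Measurable g := hf.piecewise mR measurable_const
  have hg_of_mem : ∀ x ∈ R, g x = f x := fun x hx => Set.piecewise_eq_of_mem _ _ _ hx
  have hg_of_not_mem : ∀ x ∉ R, g x = c := fun x hx => Set.piecewise_eq_of_notMem _ _ _ hx
  have hcg : ∀ x, c ≤ g x := fun x => by
    by_cases hx : x ∈ R
    · rw [hg_of_mem x hx]; exact hcf x hx
    · rw [hg_of_not_mem x hx]
  have hgM : ∀ x, g x ≤ M := fun x => by
    by_cases hx : x ∈ R
    · rw [hg_of_mem x hx]; exact hfM x hx
    · rw [hg_of_not_mem x hx]; exact hcM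
  -- `g` is MTP₂ on `πS ⊗ πS`-a.e. pair: such pairs lie in `R × R`, a sublattice, where `g = f`
  have hprod : πS.prod πS = (π.prod π).restrict (R ×ˢ R) := by rw [hπS_eq, Measure.prod_restrict]
  have hgMTP : ∀ᵐ p ∂πS.prod πS, g p.1 * g p.2 ≤ g (p.1 ⊓ p.2) * g (p.1 ⊔ p.2) := by
    rw [hprod]
    have h1 : ∀ᵐ p ∂(π.prod π).restrict (R ×ˢ R), p ∈ R ×ˢ R := ae_restrict_mem (mR.prod mR)
    filter_upwards [ae_restrict_of_ae hMTP, h1] with p hp hpR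
    rw [hg_of_mem _ hpR.1, hg_of_mem _ hpR.2, hg_of_mem _ (inf_mem_pi_of_mem hpR.1 hpR.2),
      hg_of_mem _ (sup_mem_pi_of_mem hpR.1 hpR.2)]
    exact hp
  obtain ⟨F', hF'm, ⟨M', hM', hF'M'⟩, hF'g, hF'mtp⟩ :=
    hasBorelMTP2Versions_pi (fun i => (ρ i).restrict (S i)) g hgm c M hc hM hcg hgM hgMTP
  refine ⟨R.indicator F', hF'm.indicator mR, ⟨M', hM', fun x => ?_⟩, ?_, fun x y => ?_⟩
  · by_cases hx : x ∈ R
    · rw [Set.indicator_of_mem hx]; exact hF'M' x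
    · rw [Set.indicator_of_notMem hx]; exact zero_le
  · -- `𝟙_R · F' = f` `π`-a.e.
    have h1 : ∀ᵐ x ∂π.restrict R, F' x = g x := by rw [← hπS_eq]; exact hF'g
    have h2 : ∀ᵐ x ∂π, x ∈ R → F' x = g x := (ae_restrict_iff' mR).1 h1
    filter_upwards [h2] with x hx
    by_cases hxR : x ∈ R
    · rw [Set.indicator_of_mem hxR, hx hxR, hg_of_mem x hxR]
    · rw [Set.indicator_of_notMem hxR, hf0 x hxR]
  · -- MTP₂ at every pair
    by_cases hx : x ∈ R
    · by_cases hy : y ∈ R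
      · rw [Set.indicator_of_mem hx, Set.indicator_of_mem hy, Set.indicator_of_mem (inf_mem_pi_of_mem hx hy),
          Set.indicator_of_mem (sup_mem_pi_of_mem hx hy)]
        exact hF'mtp x y
      · rw [Set.indicator_of_notMem hy, mul_zero]; exact zero_le
    · rw [Set.indicator_of_notMem hx, zero_mul]; exact zero_le

/-- Lebesgue reference measure: densities vanishing off a measurable rectangle. [this work] -/
theorem exists_measurable_mtp2_version_of_ae_volume_rectangle (S : ι → Set ℝ) (hS : ∀ i, MeasurableSet (S i))
    (f : (ι → ℝ) → ℝ≥0∞) (hf : Measurable f) {c M : ℝ≥0∞} (hc : c ≠ 0) (hM : M ≠ ∞)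
    (hcf : ∀ x ∈ Set.pi univ S, c ≤ f x) (hfM : ∀ x ∈ Set.pi univ S, f x ≤ M) (hf0 : ∀ x ∉ Set.pi univ S, f x = 0)
    (hMTP : ∀ᵐ p ∂(volume : Measure (ι → ℝ)).prod volume, f p.1 * f p.2 ≤ f (p.1 ⊓ p.2) * f (p.1 ⊔ p.2)) :
    ∃ F : (ι → ℝ) → ℝ≥0∞, Measurable F ∧ (∃ M' : ℝ≥0∞, M' ≠ ∞ ∧ ∀ x, F x ≤ M') ∧ F =ᵐ[volume] f ∧
      ∀ x y, F x * F y ≤ F (x ⊓ y) * F (x ⊔ y) := by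
  have h := exists_measurable_mtp2_version_of_ae_pi_rectangle (fun _ : ι => (volume : Measure ℝ)) S hS f hf hc hM
    hcf hfM hf0 (by rw [← volume_pi]; exact hMTP)
  rwa [← volume_pi] at h

end Summit.CriticalPhenomena.PercolationContinuityZ3.Theorems.SahiAEFourFunctions
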